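import Summits.CriticalPhenomena.PercolationContinuityZ3.Theorems.PercNearOneGluingNoHeavyLowerTailFKAnalogues
import HarnessLib

/-!
# Product measures reweighted by a function of the NUMBER of open clusters — DEFINITIONS, the bridge to `φ_{w,q}` (`h = q^k`), and the
# node `AdditiveGluingCountPos` (Kozma–Nitzan additive gluing for every such measure)

Definitions file (`--supports stmt-CriticalPhenomena-4575`), FK sub-lane `prim-bschramm-fk-1` (gen 9) of the post-continuity programme;
builds on p205010 (kernel theorem, internal audit signed; external expert review pending).  Definitions + the elementary bridge; one
`@[conjecture]` node — NOT asserted; no sorries; standard axioms.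

WHY.  The coordinator's standing question to this lane is: for which class of measures on `{0,1}^{E}` do the finite links of the
`PercNearOneGluing` chain hold?  Known (tree): NOT for all FKG-lattice measures (fk-1 g1, `FK.not_additiveGluingFKGLattice`); census-clean
for every random-cluster measure `φ_{w,q}`, `q > 0` (`FK.AdditiveGluingFKPos`, ttrl cp-hp5 down to `q = 10⁻⁵`).  This seat's exact census
(memo bschramm/FROM-fk-1-g9-ARBOREAL.md §0(C), FK-DEFS §13.2): additive gluing — and even its strong form
`μ(o ↔ A, o ↮ b) ≤ max_{a ∈ A} μ(a ↮ b)` — holds for `μ ∝ P_w · h(k(ω))` with ARBITRARY positive `h` (12 orders of magnitude, parity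
weights, the exact level-conditioned measures `P_w(· | k = j)`): 0 violations in ≈ 2.9·10⁶ checks (`K_4`–`K_6`, all `A, o, b`; random sparse
graphs on 7, 8 vertices), while cluster-SIZE weights `∏_C g(|C|)` DO violate it (17 / 111,600 on `K_5`).  The class "product measure
reweighted by the number of clusters" (⊇ every `φ_{w,q}`) is therefore the sharpest census-clean class found; this file makes it a tree object.

* `crWeight w h ω = (∏_e w_e^{ω(e)}(1−w_e)^{1−ω(e)})·h(k(ω))`, `crPartition`, `crMeasure w h` (finite sum of Dirac masses);
  `crWeight_pow` / `crMeasure_pow_eq_rcMeasureW`: `h = (q^·)` gives `φ_{w,q}` on the nose.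
* `AdditiveGluingCountPos` — `FK.AdditiveGluingUnder (crMeasure w h) A o b` for all `n`, `w`, all `h : ℕ → ℝ` with `h > 0`, all `A, o, b`.
  CONJECTURE-SHAPED, NOT asserted; `additiveGluingFKPos_of_countPos : AdditiveGluingCountPos → FK.AdditiveGluingFKPos`.
[cite: KozmaNitzan2024, Conj. 1 (p. 3); Thm. 1 (p. 7)] [cite: Grimmett2006, §1.4 eq. (1.20) (p. 15)]
-/

noncomputable section

namespace Summit.CriticalPhenomena.PercolationContinuityZ3.Theorems

namespace FK

open MeasureTheory Set Literature.Probability.LatticeModels Literature.Probability.Percolation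
open scoped Classical
open BHK2006

variable {V : Type*} [Fintype V]

/-- **Cluster-count-reweighted product weight**: `(∏_e w_e^{ω(e)}(1−w_e)^{1−ω(e)})·h(k(ω))`, `k` the number of open clusters (free count).
For `h(k) = q^k` this is the random-cluster weight `rcWeightW w q ∅`. [cite: Grimmett2006, §1.4 eq. (1.20) (p. 15)] -/
def crWeight (w : Sym2 V → unitInterval) (h : ℕ → ℝ) (ω : BondConfig V) : ℝ :=
  weight (fun e => (w e : ℝ)) ω * h (clusterCount ω ∅)

/-- The normalising constant of the cluster-count-reweighted product measure. [cite: Grimmett2006, §1.4 eq. (1.20) (p. 15)] -/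
def crPartition (w : Sym2 V → unitInterval) (h : ℕ → ℝ) : ℝ := ∑ ω : BondConfig V, crWeight w h ω

/-- **The cluster-count-reweighted product measure** `μ_{w,h} ∝ P_w · h(k)` on bond configurations of the finite vertex type `V`
(finite sum of Dirac masses; for `h = (q^·)` it is `φ_{w,q}`, `crMeasure_pow_eq_rcMeasureW`). [cite: Grimmett2006, §1.4 eq. (1.20) (p. 15)] -/
def crMeasure (w : Sym2 V → unitInterval) (h : ℕ → ℝ) : Measure (BondConfig V) :=
  ∑ ω : BondConfig V, ENNReal.ofReal (crWeight w h ω / crPartition w h) • Measure.dirac ω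

variable (w : Sym2 V → unitInterval)

/-- `h = (q^·)` gives the random-cluster weight. [cite: Grimmett2006, §1.4 eq. (1.20) (p. 15)] -/
theorem crWeight_pow (q : ℝ) (ω : BondConfig V) : crWeight w (fun k => q ^ k) ω = rcWeightW w q ∅ ω := rfl

/-- `h = (q^·)` gives the random-cluster partition function. [cite: Grimmett2006, §1.4 eq. (1.20) (p. 15)] -/
theorem crPartition_pow (q : ℝ) : crPartition w (fun k => q ^ k) = rcPartitionFunctionW w q ∅ := rfl

/-- **`h = (q^·)` gives `φ_{w,q}` on the nose.** [cite: Grimmett2006, §1.4 eq. (1.20) (p. 15)] -/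
theorem crMeasure_pow_eq_rcMeasureW (q : ℝ) : crMeasure w (fun k => q ^ k) = rcMeasureW w q ∅ := rfl

omit [Fintype V] in
/-- The coordinates of `w` lie in `[0, 1]`. [folklore] -/
private theorem coeW_nonneg'' (e : Sym2 V) : 0 ≤ (w e : ℝ) := (w e).2.1

omit [Fintype V] in
/-- The coordinates of `w` lie in `[0, 1]`. [folklore] -/
private theorem coeW_le_one'' (e : Sym2 V) : (w e : ℝ) ≤ 1 := (w e).2.2

/-- Weights are nonnegative for `h ≥ 0`. [folklore] -/
theorem crWeight_nonneg {h : ℕ → ℝ} (hh : ∀ k, 0 ≤ h k) (ω : BondConfig V) : 0 ≤ crWeight w h ω :=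
  mul_nonneg (weight_nonneg (coeW_nonneg'' w) (coeW_le_one'' w) ω) (hh _)

/-- The normalising constant is positive for `h > 0` (the configuration `{e | w_e > 1/2}` has positive product weight). [folklore] -/
theorem crPartition_pos {h : ℕ → ℝ} (hh : ∀ k, 0 < h k) : 0 < crPartition w h := by
  refine Finset.sum_pos' (fun ω _ => crWeight_nonneg w (fun k => (hh k).le) ω) ⟨{e | (1 / 2 : ℝ) < w e}, Finset.mem_univ _, ?_⟩
  refine mul_pos (Finset.prod_pos fun e _ => ?_) (hh _)
  by_cases he : (1 / 2 : ℝ) < w e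
  · rw [if_pos (show e ∈ {e | (1 / 2 : ℝ) < w e} from he)]; linarith
  · rw [if_neg (show e ∉ {e | (1 / 2 : ℝ) < w e} from he)]; linarith [not_lt.1 he, coeW_nonneg'' w e]

/-- For `h > 0` the reweighted measure is a probability measure. [folklore] -/
theorem isProbabilityMeasure_crMeasure {h : ℕ → ℝ} (hh : ∀ k, 0 < h k) : IsProbabilityMeasure (crMeasure w h) := by
  constructor
  have hZ := crPartition_pos w hh
  simp only [crMeasure, Measure.coe_finsetSum, Measure.coe_smul, Finset.sum_apply, Pi.smul_apply, measure_univ, smul_eq_mul, mul_one]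
  rw [← ENNReal.ofReal_sum_of_nonneg (fun ω _ => div_nonneg (crWeight_nonneg w (fun k => (hh k).le) ω) hZ.le), ← Finset.sum_div]
  change ENNReal.ofReal (crPartition w h / crPartition w h) = 1
  rw [div_self hZ.ne', ENNReal.ofReal_one]

/-! ### The node -/

/-- **Additive gluing for every cluster-count-reweighted product measure** (`AG_h`): for all `n`, all edge parameters `w`, every positive
`h : ℕ → ℝ` and all `A, o, b`, Kozma–Nitzan's additive gluing `μ(o ↔ b) ≥ μ(o ↔ A) − t` (`t ≥ max_a μ(a ↮ b)`) holds under
`μ = crMeasure w h ∝ P_w·h(k)`.  CONJECTURE-SHAPED STATEMENT, NOT asserted.  Contains `FK.AdditiveGluingFKPos` (`h = q^k`,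
`additiveGluingFKPos_of_countPos`) and the level-conditioned percolation measures (`h = 1{· = j}` as a limit).  Evidence (fk-1 g9, exact
rational arithmetic, 2026-08-21): 0 violations in ≈ 2.9·10⁶ instances (`K_4`–`K_6` with all `A, o, b` and `h` over 12 orders of magnitude incl.
parity/level weights; random sparse graphs on 7–8 vertices); the analogous statement for cluster-SIZE weights is FALSE (`K_5`).
[cite: KozmaNitzan2024, Conj. 1 (p. 3); Thm. 1 (p. 7)] -/
@[conjecture] def AdditiveGluingCountPos : Prop :=
  ∀ (n : ℕ) (w : Sym2 (Fin n) → unitInterval) (h : ℕ → ℝ), (∀ k, 0 < h k) →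
    ∀ (A : Finset (Fin n)) (o b : Fin n), AdditiveGluingUnder (crMeasure w h) A o b

/-- **`AdditiveGluingCountPos → FK.AdditiveGluingFKPos`** (take `h = q^k`). [cite: KozmaNitzan2024, Conj. 1 (p. 3)] [cite: Grimmett2006, §1.4 eq. (1.20) (p. 15)] -/
theorem additiveGluingFKPos_of_countPos (hc : AdditiveGluingCountPos) : AdditiveGluingFKPos := by
  intro q hq n w A o b
  have key := hc n w (fun k => q ^ k) (fun k => pow_pos hq k) A o b
  rw [crMeasure_pow_eq_rcMeasureW] at key
  exact key

end FK

end Summit.CriticalPhenomena.PercolationContinuityZ3.Theorems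

end
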